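/-
Copyright (c) 2026. All rights reserved.
Released under Apache 2.0 license as described in the file LICENSE.
Authors: abc-iut cell, seat abc-iut-L4-t14 (gen 4; proof-only: the centraliser in `PSL₂(ℝ)` of a
non-abelian subgroup acting freely on `ℍ` is trivial — the input `C_{N(Γ̄)}(Γ̄) = 1` of the slimness of
`N_{PSL₂(ℝ)}(Γ̄)^`, [AbsTopIII] Prop 4.2 (i) p.106 / Lemma 4.3 at the uniformised holomorphic model).
-/
import Literature.AnabelianGeometry.AbsoluteAnabelian.ArchimedeanHolFieldFunctorGeometricPSL
import HarnessLib

/-!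
# Centralisers of torsion-free non-abelian Fuchsian groups in `PSL₂(ℝ)` are trivial

S. Mochizuki, *Topics in absolute anabelian geometry III*, proof of Prop 4.2 (i) p. 106 l. 14–19
(kurims `paper:url-5493eb38cbb7`; bib key `MochizukiAbsTopIII2015`): the id-rigidity of the objects of
`EA` mapping to `X` "follows immediately from the slimness assertion of Lemma 4.3", i.e. from the slimness
of `Π_{[X/Aut X]} = N_{PSL₂(ℝ)}(Γ̄)^` for `X = ℍ/Γ̄` (abc-iut-L4-t14 gen 3,
`HolRS.isIdRigid_mapsTo_pslQuotient_of_isSlimGroup`, p440098).  The group-theoretic reduction of that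
slimness (abc-iut row «J2-NORMALISER-SLIM») needs, besides «`Γ̄` free of rank `≥ 2`», exactly ONE fact
about the ambient group: **the centraliser of `Γ̄` in `PSL₂(ℝ)` is trivial** (so that an automorphism
of `ℍ/Γ̄` inducing an inner automorphism of `Γ̄` is the identity).  H. M. Farkas, I. Kra, *Riemann
Surfaces*, IV.5.6 («`Aut U ≅ PSL(2, ℝ)`»).

PROOF-ONLY file (no definition, no named fact), elementary `2 × 2` algebra:

* `Matrix.two_comm_aux`, `Matrix.two_mul_comm_of_comm_of_not_scalar` — over a field, two matrices commuting with a NON-SCALAR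
  `2 × 2` matrix `A` commute with each other (both lie in `K·1 + K·A`);
* `SpecialLinearGroup.exists_smul_eq_of_trace_eq_zero` — an element of `SL(2, ℝ)` of trace `0` (an
  elliptic involution of `PSL₂(ℝ)`) FIXES a point of `ℍ`, namely `a/c + i/|c|`;
* `SpecialLinearGroup.not_anticomm_of_free` — hence no lift `γ̃` of an element of a subgroup
  `Γ̄ ≤ PSL₂(ℝ)` acting FREELY on `ℍ` (`IsCancelSMul`) anticommutes with any `z̃ ∈ SL(2, ℝ)`
  (`z̃ γ̃ = -γ̃ z̃` forces `tr γ̃ = 0`);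
* ★ `HolRS.psl_centralizer_eq_bot` — **for `Γ̄ ≤ PSL₂(ℝ)` non-abelian and acting freely on `ℍ`,
  `C_{PSL₂(ℝ)}(Γ̄) = 1`**: a central `z ≠ 1` lifts to a non-scalar `z̃`; every lift of every element of
  `Γ̄` commutes with `z̃` up to sign, hence honestly; so any two lifts commute and `Γ̄` is abelian;
* `HolRS.psl_centralizer_subgroupOf_normalizer_eq_bot` — the same inside the normaliser `N(Γ̄)`
  (the shape consumed by the finite-extension slimness theorem: `C_{N(Γ̄)}(Γ̄) = 1`).

Classical; MODEL side of [AbsTopIII] §4 only; nothing here bears on [IUTchIII] Cor. 3.12; model ≠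
reconstruction.
-/

set_option autoImplicit false

noncomputable section

open scoped UpperHalfPlane MatrixGroups

/-! ### `2 × 2` matrices commuting with a non-scalar matrix commute with each other -/

namespace Matrix

variable {K : Type*} [Field K]

/-- The scalar identities behind `two_mul_comm_of_comm_of_not_scalar`: the commutation relations of
`B = (p q; r s)` and `C = (p' q'; r' s')` with a non-scalar `A = (a b; c d)` force the entries of
`B C - C B` to vanish. [cite: FarkasKra1992, IV.5.6] -/
theorem two_comm_aux {a b c d p q r s p' q' r' s' : K} (hA : ¬ (b = 0 ∧ c = 0 ∧ a = d))
    (E1 : b * r = q * c) (E2 : q * (a - d) = b * (p - s)) (E3 : r * (a - d) = c * (p - s))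
    (F1 : b * r' = q' * c) (F2 : q' * (a - d) = b * (p' - s')) (F3 : r' * (a - d) = c * (p' - s')) :
    q * r' = q' * r ∧ q' * (p - s) = q * (p' - s') ∧ r * (p' - s') = r' * (p - s) := by
  by_cases hb : b = 0
  · by_cases hc : c = 0
    · -- `A` diagonal with `a ≠ d`: `B`, `C` are diagonal
      have had : a - d ≠ 0 := fun h => hA ⟨hb, hc, by linear_combination h⟩
      have hq : q = 0 := by
        have h0 : q * (a - d) = 0 := by rw [E2, hb, zero_mul]
        exact (mul_eq_zero.1 h0).resolve_right had
      have hr : r = 0 := by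
        have h0 : r * (a - d) = 0 := by rw [E3, hc, zero_mul]
        exact (mul_eq_zero.1 h0).resolve_right had
      have hq' : q' = 0 := by
        have h0 : q' * (a - d) = 0 := by rw [F2, hb, zero_mul]
        exact (mul_eq_zero.1 h0).resolve_right had
      have hr' : r' = 0 := by
        have h0 : r' * (a - d) = 0 := by rw [F3, hc, zero_mul]
        exact (mul_eq_zero.1 h0).resolve_right had
      refine ⟨?_, ?_, ?_⟩
      · rw [hq, hq', hr, hr']
      · rw [hq, hq']; ring
      · rw [hr, hr']; ring
    · -- `c ≠ 0`
      have L1 : q * r' = q' * r := by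
        have h0 : c * (q * r' - q' * r) = 0 := by linear_combination r * F1 - r' * E1
        have := (mul_eq_zero.1 h0).resolve_left hc
        linear_combination this
      refine ⟨L1, ?_, ?_⟩
      · have h0 : c * (q' * (p - s) - q * (p' - s')) = 0 := by
          linear_combination q * F3 - q' * E3 - (a - d) * L1
        have := (mul_eq_zero.1 h0).resolve_left hc
        linear_combination this
      · have h0 : c * (r * (p' - s') - r' * (p - s)) = 0 := by
          linear_combination r' * E3 - r * F3
        have := (mul_eq_zero.1 h0).resolve_left hc
        linear_combination this
  · -- `b ≠ 0`
    have L1 : q * r' = q' * r := by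
      have h0 : b * (q * r' - q' * r) = 0 := by linear_combination q * F1 - q' * E1
      have := (mul_eq_zero.1 h0).resolve_left hb
      linear_combination this
    refine ⟨L1, ?_, ?_⟩
    · have h0 : b * (q' * (p - s) - q * (p' - s')) = 0 := by
        linear_combination q * F2 - q' * E2
      have := (mul_eq_zero.1 h0).resolve_left hb
      linear_combination this
    · have h0 : b * (r * (p' - s') - r' * (p - s)) = 0 := by
        linear_combination r' * E2 - r * F2 - (a - d) * L1
      have := (mul_eq_zero.1 h0).resolve_left hb
      linear_combination this

/-- **Two `2 × 2` matrices over a field commuting with a non-scalar matrix `A` commute with each other**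
(each lies in the commutative algebra `K·1 + K·A`).  «Non-scalar» is spelled on entries:
`¬ (A₀₁ = 0 ∧ A₁₀ = 0 ∧ A₀₀ = A₁₁)`. [cite: FarkasKra1992, IV.5.6] -/
theorem two_mul_comm_of_comm_of_not_scalar {A B C : Matrix (Fin 2) (Fin 2) K}
    (hA : ¬ (A 0 1 = 0 ∧ A 1 0 = 0 ∧ A 0 0 = A 1 1)) (hB : A * B = B * A) (hC : A * C = C * A) :
    B * C = C * B := by
  -- the commutation relations on entries
  have e00 := congrFun (congrFun hB 0) 0
  have e01 := congrFun (congrFun hB 0) 1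
  have e10 := congrFun (congrFun hB 1) 0
  have f00 := congrFun (congrFun hC 0) 0
  have f01 := congrFun (congrFun hC 0) 1
  have f10 := congrFun (congrFun hC 1) 0
  simp only [Matrix.mul_apply, Fin.sum_univ_two, Fin.isValue] at e00 e01 e10 f00 f01 f10
  obtain ⟨G1, G2, G3⟩ := two_comm_aux (p := B 0 0) (q := B 0 1) (r := B 1 0) (s := B 1 1)
    (p' := C 0 0) (q' := C 0 1) (r' := C 1 0) (s' := C 1 1) hA
    (by linear_combination e00) (by linear_combination e01) (by linear_combination -e10)
    (by linear_combination f00) (by linear_combination f01) (by linear_combination -f10)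
  ext i j
  fin_cases i <;> fin_cases j
  · change (B * C) 0 0 = (C * B) 0 0
    simp only [Matrix.mul_apply, Fin.sum_univ_two, Fin.isValue]
    linear_combination G1
  · change (B * C) 0 1 = (C * B) 0 1
    simp only [Matrix.mul_apply, Fin.sum_univ_two, Fin.isValue]
    linear_combination G2
  · change (B * C) 1 0 = (C * B) 1 0
    simp only [Matrix.mul_apply, Fin.sum_univ_two, Fin.isValue]
    linear_combination G3
  · change (B * C) 1 1 = (C * B) 1 1
    simp only [Matrix.mul_apply, Fin.sum_univ_two, Fin.isValue]
    linear_combination -G1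

end Matrix

namespace Literature.AnabelianGeometry.AbsoluteAnabelian

open _root_.UpperHalfPlane

/-! ### Trace-zero elements of `SL(2, ℝ)` fix a point of `ℍ` -/

namespace SpecialLinearGroup

/-- **An element of `SL(2, ℝ)` of trace `0` fixes a point of `ℍ`**: with `g = (a b; c d)`, `a + d = 0`,
`-a² - bc = 1` forces `c ≠ 0`, and `τ₀ = a/c + i/|c|` satisfies `g • τ₀ = τ₀`.  (These are the lifts of
the elliptic involutions of `PSL₂(ℝ)`.) [cite: FarkasKra1992, IV.5.6] -/
theorem exists_smul_eq_of_trace_eq_zero (g : SL(2, ℝ)) (h : g 0 0 + g 1 1 = 0) :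
    ∃ τ : ℍ, g • τ = τ := by
  have hdet := g.2
  rw [Matrix.det_fin_two] at hdet
  have hd : g 1 1 = -g 0 0 := by linarith
  have hc : g 1 0 ≠ 0 := by
    intro hc
    rw [hd, hc] at hdet
    nlinarith [sq_nonneg (g 0 0)]
  -- `s = ±1` with `s / c > 0`
  obtain ⟨s, hs1, hsc⟩ : ∃ s : ℝ, s * s = 1 ∧ 0 < s / g 1 0 := by
    rcases lt_or_gt_of_ne hc with hlt | hgt
    · exact ⟨-1, by norm_num, div_pos_of_neg_of_neg (by norm_num) hlt⟩
    · exact ⟨1, by norm_num, div_pos one_pos hgt⟩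
  -- the fixed point `τ₀ = a/c + (s/c) i`
  let τ₀ : ℍ := ⟨⟨g 0 0 / g 1 0, s / g 1 0⟩, hsc⟩
  have hre : (τ₀ : ℂ).re = g 0 0 / g 1 0 := rfl
  have him : (τ₀ : ℂ).im = s / g 1 0 := rfl
  refine ⟨τ₀, ?_⟩
  apply UpperHalfPlane.ext
  rw [coe_sl_smul, div_eq_iff (sl_denom_ne_zero g τ₀.im_pos)]
  -- the denominator `c τ₀ + d = s i`
  have hden : ((g 1 0 : ℝ) : ℂ) * (τ₀ : ℂ) + (g 1 1 : ℝ) = (s : ℂ) * Complex.I := by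
    apply Complex.ext
    · simp only [Complex.add_re, Complex.mul_re, Complex.ofReal_re, Complex.ofReal_im, hre, him,
        Complex.I_re, Complex.I_im, zero_mul, sub_zero, mul_zero, mul_one]
      rw [hd]; field_simp; ring
    · simp only [Complex.add_im, Complex.mul_im, Complex.ofReal_re, Complex.ofReal_im, hre, him,
        Complex.I_re, Complex.I_im, zero_mul, add_zero, mul_zero, mul_one]
      field_simp
  rw [hden]
  apply Complex.ext
  · simp only [Complex.add_re, Complex.mul_re, Complex.ofReal_re, Complex.ofReal_im, hre, him,
      Complex.I_re, Complex.I_im, zero_mul, sub_zero, mul_zero, mul_one, Complex.mul_im, zero_sub,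
      add_zero]
    rw [hd] at hdet
    field_simp
    linear_combination -hdet + hs1
  · simp only [Complex.add_im, Complex.mul_im, Complex.ofReal_re, Complex.ofReal_im, hre, him,
      Complex.I_re, Complex.I_im, zero_mul, add_zero, mul_zero, mul_one, Complex.mul_re, sub_zero]
    field_simp

/-- **No lift of an element of a freely acting `Γ̄ ≤ PSL₂(ℝ)` anticommutes with an element of
`SL(2, ℝ)`**: if `z̃ γ̃ = -(γ̃ z̃)` then `tr γ̃ = 0` (conjugate by `z̃`), so `γ̃` fixes a point of `ℍ`, so its
image in `Γ̄` is trivial (free action), i.e. `γ̃ = ±1` — which commutes with `z̃`, forcing `γ̃ z̃ = 0`.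
[cite: FarkasKra1992, IV.5.6] -/
theorem not_anticomm_of_free (Γ : Subgroup HolRS.PSL2R) [IsCancelSMul Γ ℍ] (z g : SL(2, ℝ))
    (hg : (QuotientGroup.mk g : HolRS.PSL2R) ∈ Γ) : z * g ≠ -(g * z) := by
  intro hanti
  -- matrix form of the anticommutation and `z⁻¹ z = 1 = z z⁻¹`
  have e1 : (z : Matrix (Fin 2) (Fin 2) ℝ) * g = -((g : Matrix (Fin 2) (Fin 2) ℝ) * z) := by
    have := congrArg (fun m : SL(2, ℝ) => (m : Matrix (Fin 2) (Fin 2) ℝ)) hanti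
    simpa [Matrix.SpecialLinearGroup.coe_mul, Matrix.SpecialLinearGroup.coe_neg] using this
  have hl : ((z⁻¹ : SL(2, ℝ)) : Matrix (Fin 2) (Fin 2) ℝ) * (z : Matrix (Fin 2) (Fin 2) ℝ) = 1 := by
    rw [← Matrix.SpecialLinearGroup.coe_mul, inv_mul_cancel, Matrix.SpecialLinearGroup.coe_one]
  have hr : (z : Matrix (Fin 2) (Fin 2) ℝ) * ((z⁻¹ : SL(2, ℝ)) : Matrix (Fin 2) (Fin 2) ℝ) = 1 := by
    rw [← Matrix.SpecialLinearGroup.coe_mul, mul_inv_cancel, Matrix.SpecialLinearGroup.coe_one]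
  -- `tr g = 0`: `g = -(z⁻¹ g z)`
  have htr : g 0 0 + g 1 1 = 0 := by
    have hg' : (g : Matrix (Fin 2) (Fin 2) ℝ) =
        -(((z⁻¹ : SL(2, ℝ)) : Matrix (Fin 2) (Fin 2) ℝ) * g * z) := by
      calc (g : Matrix (Fin 2) (Fin 2) ℝ)
          = ((z⁻¹ : SL(2, ℝ)) : Matrix (Fin 2) (Fin 2) ℝ) * z * g := by rw [hl, one_mul]
        _ = ((z⁻¹ : SL(2, ℝ)) : Matrix (Fin 2) (Fin 2) ℝ) * ((z : Matrix (Fin 2) (Fin 2) ℝ) * g) := by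
            rw [mul_assoc]
        _ = -(((z⁻¹ : SL(2, ℝ)) : Matrix (Fin 2) (Fin 2) ℝ) * g * z) := by
            rw [e1, mul_neg, mul_assoc]
    have ht := congrArg Matrix.trace hg'
    rw [Matrix.trace_neg, Matrix.trace_mul_cycle, hr, one_mul, Matrix.trace_fin_two] at ht
    linarith
  -- a fixed point, hence `g ↦ 1 ∈ Γ̄`, i.e. `g` is central
  obtain ⟨τ, hτ⟩ := exists_smul_eq_of_trace_eq_zero g htr
  have h1 : (⟨QuotientGroup.mk g, hg⟩ : Γ) = 1 := by
    apply IsCancelSMul.right_cancel _ _ τ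
    rw [one_smul]
    change (QuotientGroup.mk g : HolRS.PSL2R) • τ = τ
    rw [HolRS.psl_mk_smul, hτ]
  have hgc : g ∈ Subgroup.center SL(2, ℝ) := by
    have : (QuotientGroup.mk g : HolRS.PSL2R) = 1 := congrArg Subtype.val h1
    exact (QuotientGroup.eq_one_iff g).mp this
  -- central elements commute: `g z = -(g z)`, so `g z = 0` — absurd in `SL(2, ℝ)`
  have hcomm : z * g = g * z := Subgroup.mem_center_iff.mp hgc z
  rw [hcomm] at hanti
  have hM : ((g * z : SL(2, ℝ)) : Matrix (Fin 2) (Fin 2) ℝ) = 0 := by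
    ext i j
    have hij := congrFun (congrFun
      (congrArg (fun m : SL(2, ℝ) => (m : Matrix (Fin 2) (Fin 2) ℝ)) hanti) i) j
    simp only [Matrix.SpecialLinearGroup.coe_neg, Matrix.neg_apply] at hij
    rw [Matrix.zero_apply]
    linarith
  have hdet := (g * z).2
  rw [hM, Matrix.det_zero] at hdet
  exact zero_ne_one hdet

end SpecialLinearGroup

/-! ### The centraliser of a non-abelian torsion-free Fuchsian group is trivial -/

namespace HolRS

/-- **`C_{PSL₂(ℝ)}(Γ̄) = 1` for `Γ̄ ≤ PSL₂(ℝ)` non-abelian and acting freely on `ℍ`** (e.g. a torsion-free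
Fuchsian group uniformising a hyperbolic Riemann surface): a central `z ≠ 1` lifts to a NON-SCALAR
`z̃ ∈ SL(2, ℝ)`; lifts of elements of `Γ̄` commute with `z̃` up to the sign `±1 = Z(SL(2, ℝ))`, and the
sign `-1` is excluded by `not_anticomm_of_free`; so all lifts commute with `z̃`, hence with each other
(`Matrix.two_mul_comm_of_comm_of_not_scalar`), and `Γ̄` would be abelian.  This is the input «an
automorphism of `X = ℍ/Γ̄` inducing an inner automorphism of `Γ̄ = π₁(X)` is trivial» of the slimness of
`N_{PSL₂(ℝ)}(Γ̄)^` ([AbsTopIII] Lemma 4.3 for `[X/Aut X]`). [cite: MochizukiAbsTopIII2015, Proposition 4.2 (i) proof p.106] -/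
theorem psl_centralizer_eq_bot (Γ : Subgroup PSL2R) [IsCancelSMul Γ ℍ] (hΓ : ∃ x y : Γ, x * y ≠ y * x) :
    Subgroup.centralizer (Γ : Set PSL2R) = ⊥ := by
  rw [Subgroup.eq_bot_iff_forall]
  intro z hz
  rw [Subgroup.mem_centralizer_iff] at hz
  by_contra hz1
  -- a lift `z̃`, not central, hence non-scalar
  induction z using QuotientGroup.induction_on with
  | H zt =>
    have hzc : zt ∉ Subgroup.center SL(2, ℝ) := by
      intro h
      apply hz1
      rw [← QuotientGroup.mk_one, QuotientGroup.eq, mul_one]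
      exact (Subgroup.center SL(2, ℝ)).inv_mem h
    have hns : ¬ ((zt : Matrix (Fin 2) (Fin 2) ℝ) 0 1 = 0 ∧ (zt : Matrix (Fin 2) (Fin 2) ℝ) 1 0 = 0 ∧
        (zt : Matrix (Fin 2) (Fin 2) ℝ) 0 0 = (zt : Matrix (Fin 2) (Fin 2) ℝ) 1 1) := by
      rintro ⟨h01, h10, h00⟩
      apply hzc
      rw [mem_center_sl_iff]
      have hdet := zt.2
      rw [Matrix.det_fin_two, h01, h00, h10] at hdet
      have hsq : zt 1 1 = 1 ∨ zt 1 1 = -1 := by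
        have : (zt 1 1 - 1) * (zt 1 1 + 1) = 0 := by nlinarith
        rcases mul_eq_zero.1 this with h | h
        · exact Or.inl (by linarith)
        · exact Or.inr (by linarith)
      rcases hsq with h | h
      · left; ext i j
        fin_cases i <;> fin_cases j <;> simp [h01, h10, h00, h]
      · right; ext i j
        fin_cases i <;> fin_cases j <;> simp [h01, h10, h00, h, Matrix.SpecialLinearGroup.coe_neg]
    -- every lift of every element of `Γ̄` commutes with `z̃`
    have hcomm : ∀ g : SL(2, ℝ), (QuotientGroup.mk g : PSL2R) ∈ Γ →
        (zt : Matrix (Fin 2) (Fin 2) ℝ) * g = g * zt := by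
      intro g hg
      have hq := hz (QuotientGroup.mk g) hg
      rw [← QuotientGroup.mk_mul, ← QuotientGroup.mk_mul, QuotientGroup.eq, mem_center_sl_iff] at hq
      rcases hq with h | h
      · -- `(g z)⁻¹ (z g) = 1`
        have hzg : zt * g = g * zt := (inv_mul_eq_one.mp h).symm
        have := congrArg (fun m : SL(2, ℝ) => (m : Matrix (Fin 2) (Fin 2) ℝ)) hzg
        simpa [Matrix.SpecialLinearGroup.coe_mul] using this
      · -- `(g z)⁻¹ (z g) = -1`: anticommutation, excluded
        exfalso
        have hzg : zt * g = -(g * zt) := by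
          rw [inv_mul_eq_iff_eq_mul.mp h, mul_neg_one]
        exact SpecialLinearGroup.not_anticomm_of_free Γ zt g hg hzg
    -- hence `Γ̄` is abelian
    obtain ⟨x, y, hxy⟩ := hΓ
    apply hxy
    obtain ⟨xt, hxt⟩ := QuotientGroup.mk_surjective (x : PSL2R)
    obtain ⟨yt, hyt⟩ := QuotientGroup.mk_surjective (y : PSL2R)
    have hx := hcomm xt (hxt ▸ x.2)
    have hy := hcomm yt (hyt ▸ y.2)
    have hxy' : (xt : Matrix (Fin 2) (Fin 2) ℝ) * yt = yt * xt :=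
      Matrix.two_mul_comm_of_comm_of_not_scalar hns hx hy
    have hxy'' : xt * yt = yt * xt := by
      apply Subtype.ext
      simpa [Matrix.SpecialLinearGroup.coe_mul] using hxy'
    apply Subtype.ext
    change (x : PSL2R) * y = y * x
    rw [← hxt, ← hyt, ← QuotientGroup.mk_mul, ← QuotientGroup.mk_mul, hxy'']

/-- The same inside the normaliser: **`C_{N(Γ̄)}(Γ̄) = 1`** for `N(Γ̄) = N_{PSL₂(ℝ)}(Γ̄)`, `Γ̄` non-abelian
acting freely on `ℍ` — the hypothesis shape of the finite-extension slimness theorem for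
`N(Γ̄) ⊇ Γ̄`. [cite: MochizukiAbsTopIII2015, Proposition 4.2 (i) proof p.106] -/
theorem psl_centralizer_subgroupOf_normalizer_eq_bot (Γ : Subgroup PSL2R) [IsCancelSMul Γ ℍ]
    (hΓ : ∃ x y : Γ, x * y ≠ y * x) :
    Subgroup.centralizer
        ((Γ.subgroupOf (Subgroup.normalizer (Γ : Set PSL2R)) :
          Set (Subgroup.normalizer (Γ : Set PSL2R)))) = ⊥ := by
  rw [Subgroup.eq_bot_iff_forall]
  intro z hz
  rw [Subgroup.mem_centralizer_iff] at hz
  have hz' : (z : PSL2R) ∈ Subgroup.centralizer (Γ : Set PSL2R) := by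
    rw [Subgroup.mem_centralizer_iff]
    intro g hg
    have := hz ⟨g, Subgroup.le_normalizer hg⟩ (Subgroup.mem_subgroupOf.mpr hg)
    simpa using congrArg Subtype.val this
  rw [psl_centralizer_eq_bot Γ hΓ, Subgroup.mem_bot] at hz'
  exact Subtype.ext hz'

end HolRS

end Literature.AnabelianGeometry.AbsoluteAnabelian

end
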